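import Mathlib.LinearAlgebra.Isomorphisms
import Mathlib.RingTheory.QuotSMulTop
import HarnessLib

/-!
# Route `SignedLowerHalves`, crux L `SmallImageLowerHalfBothSigns` (item stmt-BirchSwinnertonDyer-23599), line `rtt_w3` v13 — E2, row D2: the
# double-quotient swap for a GENERAL submodule — `(M ⧸ Z) ⧸ f(M ⧸ Z) ≃ (M ⧸ fM) ⧸ Z̄`, `Z̄` the image of `Z` — identifying `QuotSMulTop f (H¹ ⧸ Z)`
# (the module of `…RttD2SpecialisationOfSkeleton`) with `Hsp ⧸ ZSp` (the module of the glue's `hK`, `Hsp = H¹ ⧸ fH¹`, `ZSp = Z.map mk`)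

Width seat `bsd-line-slh-p3-w3` g19 under LEAD `cruxlead-stmt-BirchSwinnertonDyer-23599` g9; ROUTE-INDEPENDENT helper (`--supports stmt-BirchSwinnertonDyer-23599`);
THEOREMS ONLY; pure module algebra over any commutative ring; closes nothing; BSD is not proved by any of this. Generalises (B2) of
`…RttD2DescentAlgebra` (there `Z = R∙z`).

* `nonempty_quotSMulTop_quotient_linearEquiv_quotient_map` — `QuotSMulTop f (M ⧸ Z) ≃ₗ[R] (QuotSMulTop f M) ⧸ Z.map (f•⊤).mkQ` (both are `M ⧸ (fM ⊔ Z)`).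

References: [BourbakiAC5to7] VII §4.5; [JohnsonLeungKings2011] §4.2 Lemma 4.4.
-/

set_option autoImplicit false
-- the Theorems namespace of this sub repeats the summit name by design (D-0017 nested layout)
set_option linter.dupNamespace false

noncomputable section

open scoped Pointwise

namespace Summit.BirchSwinnertonDyer.BirchSwinnertonDyer.Theorems.SmallImageRttD2Descent

variable {R : Type*} [CommRing R] {M : Type*} [AddCommGroup M] [Module R M] (f : R) (Z : Submodule R M)

/-- **`(M ⧸ Z) ⧸ f(M ⧸ Z) ≃ₗ[R] (M ⧸ fM) ⧸ Z̄`**, `Z̄ = Z.map mk` — both are `M ⧸ (fM ⊔ Z)`. Road D: `QuotSMulTop f (H¹₂ ⧸ Z) ≅ Hsp ⧸ ZSp`.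
[cite: BourbakiAC5to7, VII §4.5] -/
theorem nonempty_quotSMulTop_quotient_linearEquiv_quotient_map :
    Nonempty (QuotSMulTop f (M ⧸ Z) ≃ₗ[R] ((QuotSMulTop f M) ⧸ Z.map (f • (⊤ : Submodule R M)).mkQ)) := by
  -- `f • ⊤` in `M ⧸ Z` is the image of `f • ⊤`
  have hL : (f • (⊤ : Submodule R (M ⧸ Z))) = (f • (⊤ : Submodule R M)).map Z.mkQ := by
    rw [Submodule.map_pointwise_smul, Submodule.map_top, Submodule.range_mkQ]
  exact ⟨(Submodule.quotEquivOfEq _ _ hL).trans ((Submodule.quotientQuotientEquivQuotientSup _ _).trans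
    ((Submodule.quotEquivOfEq _ _ (sup_comm _ _)).trans (Submodule.quotientQuotientEquivQuotientSup _ _).symm))⟩

end Summit.BirchSwinnertonDyer.BirchSwinnertonDyer.Theorems.SmallImageRttD2Descent

end
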